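import Summits.QuantumFields.BalabanUV.T4Continuum.Support.NE7K1LinRegionLine
import Literature.MathematicalPhysics.QuantumFieldTheory.Balaban1983to89.B4Cor23Zero

/-!
# NE7K1LinSchurLineU1Energy — row NE7 (node U5), candidate route HOM, path H1L, cell K1-lin(s): THE COMBES–THOMAS ENERGY METHOD OF
# B4 COROLLARY 2.3 ON THE √s-EXTENDED TWO-CUTOFF SYSTEM — the coarse Dirichlet form is dominated by the extended energy
# (`Σ_x(D_μw_c)(x)² ≤ ⟨ŵ, 𝒫(s)ŵ⟩`), the two energy bounds (source `g` ∕ source `D_ν^⊤f′`) and the two extraction lemmas (values ∕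
# gradients on a far set), EVERY `s ∈ [0,1]`, EVERY mesh, EVERY union of blocks — the groundwork for the three DERIVATIVE pairings of (2.30)

Lineage `b2b-balaban-t4-ne7-p2` (CRUX PROVER NE7 #2), generation 78; file 91 (the stretch after the (o3-Ω) set 85–90).  b04's
`B4Cor23Zero` §A–§D (energy `E ≤ 2P`, `P² ≤ K·E`) re-run on the EXTENDED index `coarse ⊕ fine` with the operator
`𝒫(s) = extOpR(runA, runB blocks, s)`: the coarse component of `𝒫(s)⁻¹(g, 0)` is `(twoCutoffLine s)⁻¹g` (file 85), the weight is
file 86's `δ·dist_η(·,T)` pulled back block-constantly, and the ONE new inequality is the DIRICHLET DOMINATION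
`Σ_x(D_μ w_c)(x)² ≤ ⟨w_c, P_A w_c⟩ ≤ ⟨ŵ, 𝒫(s)ŵ⟩` (b04's (2.29)-at-`A = 0` `sum_fdiff_sq_le_form` + the bilinear identity
`form₂_extOpR` + `NE7K1LinTwoRunKit.schur_form_le` + the two-run Jensen bound `runA_form_le_schurB_sharp`).

* §1 generic: `energy_le_of_supp` (any matrix: `E ≤ (4∕σ)‖g‖²` for a source supported where the weight is `≤ 0`).
* §2 `extU1` (the √s-extended U = 1 operator), `runB_blocks_transpose ∕ _symm₂₂`, `runB_coercive`, `runB₂₂_psd ∕ _isUnit`,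
  **`runA_form_le_extU1`** (`⟨w_c, P_A w_c⟩ ≤ ⟨ŵ, 𝒫(s)ŵ⟩`), **`sum_fdiff_sq_le_extU1`** (Dirichlet domination).
* §3 the weight `rhoT = δ·dT ∘ site` and the two Combes–Thomas hypotheses of `𝒫(s)` at it (`extU1_coercive`, `extU1_conjError`),
  `rhoT_lip_step` (bond oscillation `≤ δ∕n` on the coarse lattice).
* (file 92 `NE7K1LinSchurLineU1EnergyBounds`) §4 `energyA_ext`, `energyB_ext`, `sum_sq_le_extEnergy`, `sum_fdiff_sq_le_extEnergy`.

HONEST FRAMING: [folklore]; A = 0; nothing printed asserted; no `sorry`.  Census only; NE7 NOT PRINTED ∕ NOT PROVED; spine 0∕9; FIXED FINITE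
T⁴, rung (B)+1; NOT infinite volume, NOT mass gap, NOT Clay.  HONEST DEPENDENCY: continuum YM on T⁴ ⇐ BetaPertH ∧ nine spine estimates (0/9
proved); BetaPertH ⇐ (D1) ∧ (D4) ∧ CAP+tail; G-an2-4 gates asym, D1 and NE2/3/4.
-/

noncomputable section

open Finset Matrix

namespace Summit.QuantumFields.BalabanUV.T4Continuum.NE7K1LinSchurLineU1Energy

open Literature.MathematicalPhysics.QuantumFieldTheory.Balaban1983to89
open Literature.MathematicalPhysics.QuantumFieldTheory.Balaban1983to89.B4ContourShift (supNorm supNorm_nonneg)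
open Literature.MathematicalPhysics.QuantumFieldTheory.Balaban1983to89.B4Reflection242
open Literature.MathematicalPhysics.QuantumFieldTheory.Balaban1983to89.B4BoxCov237
open Literature.MathematicalPhysics.QuantumFieldTheory.Balaban1983to89.B4Lower18
open Literature.MathematicalPhysics.QuantumFieldTheory.Balaban1983to89.B4Thm110ZeroBox (blk_blk)
open Literature.MathematicalPhysics.QuantumFieldTheory.Balaban1983to89.B4Cor23Zero (fdiff fdiffT extR dot_fdiffT
  sum_fdiff_sq_le_form sum_sq_shift_le abs_fdiff_weighted_le exp_mul_abs_fdiff_le energy_le_two_conjPairing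
  le_four_mul_of_sq_le sq_sum_mul_le add_uvec_mem_nbrs)
open Literature.MathematicalPhysics.QuantumFieldTheory.Balaban1983to89.Beta.CombesThomasFormOp (setSq_le_of_weightedSq
  weightedSq_le_of_support)
open NE7K1LinSchurLineForm NE7K1LinSchurLineCoords NE7K1LinFineOpWeight NE7K1LinBlockCoords NE7K1LinSchurLineU1
open NE7K1LinTwoRunKit NE7K1LinTwoRunUpper NE7K1LinTwoRunJensen NE7K1LinSchurLineU1Set

variable {d : ℕ}

/-! ### §1 A generic energy bound -/

/-- **ENERGY BOUND, CASE A, GENERIC**: for any matrix `H` that is `σ`-coercive with conjugation error `≥ −(σ∕2)‖·‖²` at the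
weight `φ`, any source `g` supported in `T` with `φ ≤ 0` on `T`, and `Hv = g`, `w = e^{φ}v`: `⟨w, Hw⟩ ≤ (4∕σ)·Σg²`
(b04's `energyA`, index-free). [cite: CombesThomas1973, §II] [folklore] -/
theorem energy_le_of_supp {ι : Type*} [Fintype ι] [DecidableEq ι] (H : Matrix ι ι ℝ) {σ : ℝ} (hσ : 0 < σ)
    (φ : ι → ℝ) (hpos : ∀ ω : ι → ℝ, σ * (ω ⬝ᵥ ω) ≤ ω ⬝ᵥ H.mulVec ω)
    (herr : ∀ w : ι → ℝ, -(σ / 2) * (w ⬝ᵥ w) ≤ ∑ j, ∑ k, (Real.exp (φ j - φ k) - 1) * H j k * (w j * w k))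
    (T : Finset ι) (hφT : ∀ j ∈ T, φ j ≤ 0) (g v w : ι → ℝ) (hg : ∀ j, j ∉ T → g j = 0) (hv : H.mulVec v = g)
    (hw : ∀ j, w j = Real.exp (φ j) * v j) : w ⬝ᵥ H.mulVec w ≤ 4 / σ * ∑ j, g j ^ 2 := by
  have hE2P := energy_le_two_conjPairing H σ φ hpos herr v w hw
  rw [hv] at hE2P
  have hposw := hpos w
  have hww : 0 ≤ w ⬝ᵥ w := by simp only [dotProduct]; exact Finset.sum_nonneg fun j _ => mul_self_nonneg _
  have hE0 : 0 ≤ w ⬝ᵥ H.mulVec w := le_trans (mul_nonneg hσ.le hww) hposw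
  have hG : ∑ j, (Real.exp (φ j) * g j) ^ 2 ≤ ∑ j, g j ^ 2 := by
    have := weightedSq_le_of_support φ g T 0 hg hφT
    simpa using this
  have hwsq : w ⬝ᵥ w = ∑ j, w j ^ 2 := by simp only [dotProduct, sq]
  have hP2 : (∑ j, w j * (Real.exp (φ j) * g j)) ^ 2 ≤ (∑ j, g j ^ 2) / σ * (w ⬝ᵥ H.mulVec w) := by
    calc (∑ j, w j * (Real.exp (φ j) * g j)) ^ 2
        ≤ (∑ j, w j ^ 2) * ∑ j, (Real.exp (φ j) * g j) ^ 2 := sq_sum_mul_le _ _ _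
      _ ≤ (w ⬝ᵥ w) * ∑ j, g j ^ 2 := by
          rw [hwsq]
          exact mul_le_mul_of_nonneg_left hG (Finset.sum_nonneg fun j _ => sq_nonneg _)
      _ ≤ (w ⬝ᵥ H.mulVec w / σ) * ∑ j, g j ^ 2 := by
          refine mul_le_mul_of_nonneg_right ?_ (Finset.sum_nonneg fun j _ => sq_nonneg _)
          rw [le_div_iff₀ hσ, mul_comm]; exact hposw
      _ = (∑ j, g j ^ 2) / σ * (w ⬝ᵥ H.mulVec w) := by ring
  have h := le_four_mul_of_sq_le hE0 (by positivity) hE2P hP2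
  calc w ⬝ᵥ H.mulVec w ≤ 4 * ((∑ j, g j ^ 2) / σ) := h
    _ = 4 / σ * ∑ j, g j ^ 2 := by ring

/-! ### §2 The √s-extended U = 1 operator and the Dirichlet domination -/

section Ext

variable {n L : ℕ} [NeZero L] {R' : Finset (Fin (d + 1) → ℤ)}

/-- **THE √s-EXTENDED TWO-CUTOFF OPERATOR AT U = 1**: `𝒫(s) = [[(1−s)P_A + s(H_B)₁₁, √s(H_B)₁₂],[√s(H_B)₂₁, (H_B)₂₂]]` on run A's
sites ⊕ the in-block fluctuation coordinates (`NE7K1LinSchurLineForm.extOpR` of the two runs). [folklore] -/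
def extU1 (hR'L : IsBlockUnion L R') (n : ℕ) (a s : ℝ) :
    Matrix (↥(R'.image (blk L)) ⊕ (↥(R'.image (blk L)) × NZ d L)) (↥(R'.image (blk L)) ⊕ (↥(R'.image (blk L)) × NZ d L)) ℝ :=
  extOpR (runA n L a R') (runB hR'L n a).toBlocks₁₁ (runB hR'L n a).toBlocks₁₂ (runB hR'L n a).toBlocks₂₁
    (runB hR'L n a).toBlocks₂₂ s

/-- the off-diagonal blocks of the symmetric `H_B` are transposes of each other. [folklore] -/
theorem runB_blocks_transpose (hR'L : IsBlockUnion L R') (n : ℕ) (a : ℝ) :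
    ((runB hR'L n a).toBlocks₁₂)ᵀ = (runB hR'L n a).toBlocks₂₁ := by
  ext j i
  simp only [Matrix.transpose_apply, Matrix.toBlocks₁₂, Matrix.toBlocks₂₁, Matrix.of_apply]
  exact (runB_isSymm hR'L n a).apply _ _

/-- the fine block of `H_B` is symmetric. [folklore] -/
theorem runB_symm₂₂ (hR'L : IsBlockUnion L R') (n : ℕ) (a : ℝ) : ((runB hR'L n a).toBlocks₂₂).IsSymm := by
  ext j i
  simp only [Matrix.transpose_apply, Matrix.toBlocks₂₂, Matrix.of_apply]
  exact (runB_isSymm hR'L n a).apply _ _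

/-- **COERCIVITY OF `H_B`** with the floor `σ = min(2,a)∕L^{d+1}` (file 86's step (2)). [folklore] -/
theorem runB_coercive (hn : 1 ≤ n) (hR' : IsBlockUnion (n * L) R') {a : ℝ} (ha : 0 < a)
    (u : ↥(R'.image (blk L)) ⊕ (↥(R'.image (blk L)) × NZ d L) → ℝ) :
    min 2 a / (L : ℝ) ^ (d + 1) * (u ⬝ᵥ u) ≤ u ⬝ᵥ (runB (isBlockUnion_fine hR') n a).mulVec u := by
  have hL : 1 ≤ L := NeZero.one_le
  have hL0 : (0 : ℝ) < L := by exact_mod_cast hL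
  have hnL : 1 ≤ n * L := Nat.one_le_iff_ne_zero.2 (Nat.mul_ne_zero (Nat.one_le_iff_ne_zero.1 hn) (NeZero.ne L))
  have hmin : 0 < min 2 a := lt_min (by norm_num) ha
  have h := coercive_congr (coordT (isBlockUnion_fine hR')) (fineOpR (n * L) a 0 R') (c := ((L : ℝ) ^ (d + 1))⁻¹)
    (σM := min 2 a) (cT := 1) (by positivity) hmin.le (fun φ => lower18_zero hnL ha.le hR' φ)
    (dot_le_coordT (isBlockUnion_fine hR')) u
  have hσ' : ((L : ℝ) ^ (d + 1))⁻¹ * min 2 a * 1 = min 2 a / (L : ℝ) ^ (d + 1) := by field_simp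
  rw [hσ'] at h
  exact h

/-- the fine block of `H_B` is positive semidefinite. [folklore] -/
theorem runB₂₂_psd (hn : 1 ≤ n) (hR' : IsBlockUnion (n * L) R') {a : ℝ} (ha : 0 < a) (φ : ↥(R'.image (blk L)) × NZ d L → ℝ) :
    0 ≤ φ ⬝ᵥ ((runB (isBlockUnion_fine hR') n a).toBlocks₂₂).mulVec φ := by
  have hL0 : (0 : ℝ) < L := by exact_mod_cast (NeZero.one_le : 1 ≤ L)
  have h := runB_coercive hn hR' ha (Sum.elim 0 φ)
  conv_rhs at h => rw [← fromBlocks_toBlocks (runB (isBlockUnion_fine hR') n a)]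
  rw [fromBlocks_mulVec, Sum.elim_comp_inl, Sum.elim_comp_inr, sumElim_dotProduct_sumElim, sumElim_dotProduct_sumElim,
    mulVec_zero, mulVec_zero, zero_add, zero_add, zero_dotProduct, zero_dotProduct, zero_add, zero_add] at h
  have hφ : 0 ≤ φ ⬝ᵥ φ := by simp only [dotProduct]; exact Finset.sum_nonneg fun j _ => mul_self_nonneg _
  exact le_trans (mul_nonneg (div_pos (lt_min (by norm_num) ha) (by positivity)).le hφ) h

/-- the fine block of `H_B` is invertible. [folklore] -/
theorem runB₂₂_isUnit (hn : 1 ≤ n) (hR' : IsBlockUnion (n * L) R') {a : ℝ} (ha : 0 < a) :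
    IsUnit ((runB (isBlockUnion_fine hR') n a).toBlocks₂₂).det := by
  have hL0 : (0 : ℝ) < L := by exact_mod_cast (NeZero.one_le : 1 ≤ L)
  have hσ : 0 < min 2 a / (L : ℝ) ^ (d + 1) := div_pos (lt_min (by norm_num) ha) (by positivity)
  refine isUnit_det_fineR (runB (isBlockUnion_fine hR') n a).toBlocks₁₁ (runB (isBlockUnion_fine hR') n a).toBlocks₁₂
    (runB (isBlockUnion_fine hR') n a).toBlocks₂₁ _ hσ fun u => ?_
  rw [fromBlocks_toBlocks]
  exact runB_coercive hn hR' ha u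

/-- **RUN A IS BELOW THE EXTENDED ENERGY**: `⟨w_c, P_A w_c⟩ ≤ ⟨ŵ, 𝒫(s)ŵ⟩` for every `ŵ = (w_c, w_f)` and every `s ∈ [0,1]` —
`⟨ŵ,𝒫(s)ŵ⟩ = (1−s)⟨w_c,P_Aw_c⟩ + ⟨(√s w_c, w_f), H_B(√s w_c, w_f)⟩` and the second term dominates the Schur form at `√s w_c`,
i.e. `s⟨w_c, P_B^{Schur}w_c⟩ ≥ s⟨w_c, P_A w_c⟩` (two-run Jensen). [folklore] -/
theorem runA_form_le_extU1 (hn : 1 ≤ n) (hR' : IsBlockUnion (n * L) R') {a : ℝ} (ha : 0 < a) {s : ℝ} (hs0 : 0 ≤ s)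
    (w : ↥(R'.image (blk L)) ⊕ (↥(R'.image (blk L)) × NZ d L) → ℝ) :
    (w ∘ Sum.inl) ⬝ᵥ (runA n L a R').mulVec (w ∘ Sum.inl) ≤ w ⬝ᵥ (extU1 (isBlockUnion_fine hR') n a s).mulVec w := by
  set hR'L := isBlockUnion_fine hR'
  set H := runB hR'L n a with hH
  set V := w ∘ Sum.inl with hV
  rw [extU1, form₂_extOpR _ _ _ _ _ hs0, fromBlocks_toBlocks]
  -- the H_B form at (√s V, w_f) dominates the Schur form at √s V
  have hschur := schur_form_le H.toBlocks₁₁ H.toBlocks₁₂ H.toBlocks₂₁ H.toBlocks₂₂ (runB_blocks_transpose hR'L n a)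
    (runB_symm₂₂ hR'L n a) (runB₂₂_isUnit hn hR' ha) (runB₂₂_psd hn hR' ha) (Real.sqrt s • V) (w ∘ Sum.inr)
  rw [← twoCutoffLine_one hR'L n a, fromBlocks_toBlocks] at hschur
  have huv : uvecR s w = Sum.elim (Real.sqrt s • V) (w ∘ Sum.inr) := rfl
  rw [huv]
  have hjensen := runA_form_le_schurB_sharp hn hR' ha (Real.sqrt s • V)
  have hscale : (Real.sqrt s • V) ⬝ᵥ (runA n L a R').mulVec (Real.sqrt s • V) = s * (V ⬝ᵥ (runA n L a R').mulVec V) := by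
    rw [mulVec_smul, smul_dotProduct, dotProduct_smul, smul_eq_mul, smul_eq_mul, ← mul_assoc, Real.mul_self_sqrt hs0]
  rw [hscale] at hjensen
  have hX : 0 ≤ V ⬝ᵥ (runA n L a R').mulVec V :=
    le_trans (mul_nonneg (lt_min (by norm_num) ha).le (Finset.sum_nonneg fun i _ => mul_self_nonneg (V i)))
      (lower18_zero hn ha.le (isBlockUnion_coarse NeZero.one_le hR') V)
  nlinarith [hjensen, hschur, hX]

/-- **DIRICHLET DOMINATION**: `Σ_x (D_μ w_c)(x)² ≤ ⟨ŵ, 𝒫(s)ŵ⟩` for every `ŵ`, every `s ∈ [0,1]`, every direction — b04's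
(2.29)-at-`A = 0` `sum_fdiff_sq_le_form` for run A behind `runA_form_le_extU1`. [folklore] -/
theorem sum_fdiff_sq_le_extU1 (hn : 1 ≤ n) (hR' : IsBlockUnion (n * L) R') {a : ℝ} (ha : 0 < a) {s : ℝ} (hs0 : 0 ≤ s)
    (μ : Fin (d + 1)) (w : ↥(R'.image (blk L)) ⊕ (↥(R'.image (blk L)) × NZ d L) → ℝ) :
    ∑ x, fdiff n (R'.image (blk L)) μ (w ∘ Sum.inl) x ^ 2 ≤ w ⬝ᵥ (extU1 (isBlockUnion_fine hR') n a s).mulVec w :=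
  (sum_fdiff_sq_le_form hn (isBlockUnion_coarse NeZero.one_le hR') ha.le le_rfl μ (w ∘ Sum.inl)).trans
    (runA_form_le_extU1 hn hR' ha hs0 w)

end Ext

/-! ### §3 The weight and the two Combes–Thomas hypotheses of `𝒫(s)` -/

section Weight

variable {n L : ℕ} [NeZero L] {R' : Finset (Fin (d + 1) → ℤ)}

/-- the weight `ρ_T = δ·dist_η(·,T) ∘ site` on coarse ⊕ fluctuation coordinates (block-constant on the fluctuations). [folklore] -/
def rhoT (n : ℕ) (δ : ℝ) (T : Finset ↥(R'.image (blk L))) (hT : T.Nonempty)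
    (c : ↥(R'.image (blk L)) ⊕ (↥(R'.image (blk L)) × NZ d L)) : ℝ :=
  δ * dT n (R'.image (blk L)) T hT (site c)

/-- on run A's sites the weight oscillates by at most `δ∕n` across a bond. [folklore] -/
theorem rhoT_lip_step (hn : 1 ≤ n) {δ : ℝ} (hδ0 : 0 ≤ δ) (T : Finset ↥(R'.image (blk L))) (hT : T.Nonempty)
    (μ : Fin (d + 1)) (x : ↥(R'.image (blk L))) (h : x.1 + uvec μ ∈ R'.image (blk L)) :
    |rhoT n δ T hT (Sum.inl ⟨x.1 + uvec μ, h⟩) - rhoT n δ T hT (Sum.inl x)| ≤ δ / (n : ℝ) := by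
  simp only [rhoT, site, ← mul_sub, abs_mul, abs_of_nonneg hδ0]
  have h1 := abs_dT_sub_le hn T hT ⟨x.1 + uvec μ, h⟩ x
  have h2 : supNorm ((x.1 + uvec μ) - x.1) ≤ 1 := by
    rw [show (x.1 + uvec μ) - x.1 = -(x.1 - (x.1 + uvec μ)) by abel, B4TorusKernel.supNorm_neg]
    exact supNorm_sub_le_one_of_mem_nbrs (add_uvec_mem_nbrs x.1 μ)
  calc δ * |dT n (R'.image (blk L)) T hT ⟨x.1 + uvec μ, h⟩ - dT n (R'.image (blk L)) T hT x|
      ≤ δ * ((1 / (n : ℝ)) * 1) := mul_le_mul_of_nonneg_left (h1.trans (mul_le_mul_of_nonneg_left h2 (by positivity))) hδ0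
    _ = δ / (n : ℝ) := by ring

/-- **THE TWO COMBES–THOMAS HYPOTHESES OF `𝒫(s)` AT THE WEIGHT `ρ_T`** — coercivity `σ = min(2,a)∕L^{d+1}` and conjugation error
`≥ −(σ∕2)‖·‖²` in the mesh-free window, for every `s ∈ [0,1]` (file 86's steps (1)–(5) recorded as a lemma). [folklore] -/
theorem extU1_hyps (hn : 1 ≤ n) (hR' : IsBlockUnion (n * L) R') {a δ : ℝ} (ha : 0 < a) (hδ0 : 0 ≤ δ) (hδ1 : δ ≤ 1)
    (hsmall : 2 * (2 * ((d : ℝ) + 1) * (δ * L) ^ 2 + a * (Real.exp δ - 1)) ≤ (min 2 a / (L : ℝ) ^ (d + 1)) / 2)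
    {s : ℝ} (hs0 : 0 ≤ s) (hs1 : s ≤ 1) (T : Finset ↥(R'.image (blk L))) (hT : T.Nonempty) :
    (∀ w, min 2 a / (L : ℝ) ^ (d + 1) * (w ⬝ᵥ w) ≤ w ⬝ᵥ (extU1 (isBlockUnion_fine hR') n a s).mulVec w) ∧
    (∀ w, -(min 2 a / (L : ℝ) ^ (d + 1) / 2) * (w ⬝ᵥ w) ≤
      ∑ j, ∑ k, (Real.exp (rhoT n δ T hT j - rhoT n δ T hT k) - 1) * extU1 (isBlockUnion_fine hR') n a s j k * (w j * w k)) := by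
  classical
  have hL : 1 ≤ L := NeZero.one_le
  have hR'L : IsBlockUnion L R' := isBlockUnion_fine hR'
  have hRc : IsBlockUnion n (R'.image (blk L)) := isBlockUnion_coarse hL hR'
  have hnL : 1 ≤ n * L := Nat.one_le_iff_ne_zero.2 (Nat.mul_ne_zero (Nat.one_le_iff_ne_zero.1 hn) (NeZero.ne L))
  have hn0 : (0 : ℝ) < n := by exact_mod_cast hn
  have hL0 : (0 : ℝ) < L := by exact_mod_cast hL
  have hLpow : (0 : ℝ) < (L : ℝ) ^ (d + 1) := by positivity
  have hLpow1 : (1 : ℝ) ≤ (L : ℝ) ^ (d + 1) := one_le_pow₀ (by exact_mod_cast hL)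
  have hmin : 0 < min 2 a := lt_min (by norm_num) ha
  set σ : ℝ := min 2 a / (L : ℝ) ^ (d + 1) with hσdef
  have hσle : σ ≤ min 2 a := div_le_self hmin.le hLpow1
  have hexp : 0 ≤ Real.exp δ - 1 := by linarith [Real.add_one_le_exp δ]
  set ρ : ↥(R'.image (blk L)) ⊕ (↥(R'.image (blk L)) × NZ d L) → ℝ := rhoT n δ T hT with hρ
  set ρ' : ↥R' → ℝ := fun x' => δ * dT n (R'.image (blk L)) T hT (rblk L R' x') with hρ'
  have hP₀ : ∀ g : ↥(R'.image (blk L)) → ℝ, σ * (g ⬝ᵥ g) ≤ g ⬝ᵥ (runA n L a R').mulVec g := by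
    intro g
    have hg : 0 ≤ g ⬝ᵥ g := by simp only [dotProduct]; exact Finset.sum_nonneg fun _ _ => mul_self_nonneg _
    exact (mul_le_mul_of_nonneg_right hσle hg).trans (lower18_zero hn ha.le hRc g)
  have hH₁ : ∀ u, σ * (u ⬝ᵥ u) ≤ u ⬝ᵥ (runB hR'L n a).mulVec u := fun u => runB_coercive hn hR' ha u
  have hbondA : ∀ x₁ x₂ : ↥(R'.image (blk L)), x₂.1 ∈ nbrs x₁.1 → |ρ (Sum.inl x₁) - ρ (Sum.inl x₂)| ≤ δ * (1 / (n : ℝ)) := by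
    intro x₁ x₂ h12
    simp only [hρ, rhoT, site, ← mul_sub, abs_mul, abs_of_nonneg hδ0]
    refine mul_le_mul_of_nonneg_left ((abs_dT_sub_le hn T hT x₁ x₂).trans ?_) hδ0
    exact (mul_le_mul_of_nonneg_left (supNorm_sub_le_one_of_mem_nbrs h12) (by positivity)).trans (by rw [mul_one])
  have hblockA : ∀ x₁ x₂ : ↥(R'.image (blk L)), blk n x₁.1 = blk n x₂.1 → |ρ (Sum.inl x₁) - ρ (Sum.inl x₂)| ≤ δ := by
    intro x₁ x₂ h12
    simp only [hρ, rhoT, site, ← mul_sub, abs_mul, abs_of_nonneg hδ0]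
    refine (mul_le_mul_of_nonneg_left ((abs_dT_sub_le hn T hT x₁ x₂).trans ?_) hδ0).trans (by rw [mul_one])
    calc (1 / (n : ℝ)) * supNorm (x₁.1 - x₂.1) ≤ (1 / (n : ℝ)) * ((n : ℝ) - 1) :=
          mul_le_mul_of_nonneg_left (supNorm_sub_le_of_blk_eq hn h12) (by positivity)
      _ ≤ 1 := by rw [div_mul_eq_mul_div, one_mul, div_le_one hn0]; linarith
  have h₀ : ∀ g : ↥(R'.image (blk L)) → ℝ, -(σ / 2) * (g ⬝ᵥ g) ≤
      ∑ j, ∑ k, (Real.exp (ρ (Sum.inl j) - ρ (Sum.inl k)) - 1) * runA n L a R' j k * (g j * g k) := by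
    intro g
    have hδn : δ * (1 / (n : ℝ)) ≤ 1 := by
      calc δ * (1 / (n : ℝ)) ≤ 1 * 1 := mul_le_mul hδ1 (by rw [div_le_one hn0]; exact_mod_cast hn) (by positivity) zero_le_one
        _ = 1 := one_mul 1
    have h := conjError_fineOpR_ge hn hRc ha.le hδn hδ0 (fun z => ρ (Sum.inl z)) hbondA hblockA g
    have hg : 0 ≤ g ⬝ᵥ g := by simp only [dotProduct]; exact Finset.sum_nonneg fun _ _ => mul_self_nonneg _
    have hκ : 2 * ((d : ℝ) + 1) * δ ^ 2 + a * (Real.exp δ - 1) ≤ σ / 2 := by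
      have hL1 : (1 : ℝ) ≤ (L : ℝ) := by exact_mod_cast hL
      have hδL : δ ^ 2 ≤ (δ * L) ^ 2 := by
        rw [mul_pow]; nlinarith [sq_nonneg δ, mul_nonneg (sq_nonneg δ) (by nlinarith : (0 : ℝ) ≤ (L : ℝ) ^ 2 - 1)]
      nlinarith [mul_nonneg ha.le hexp, hδL]
    exact le_trans (by nlinarith) h
  have hcompat : ∀ x' c, coordT hR'L x' c ≠ 0 → ρ' x' = ρ c := by
    intro x' c h
    simp only [hρ, rhoT, hρ', coordT_compat hR'L x' c h]
  have hbondB : ∀ x₁ x₂ : ↥R', x₂.1 ∈ nbrs x₁.1 → |ρ' x₁ - ρ' x₂| ≤ (δ * L) * (1 / ((n * L : ℕ) : ℝ)) := by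
    intro x₁ x₂ h12
    simp only [hρ', ← mul_sub, abs_mul, abs_of_nonneg hδ0]
    have hkey : (1 / (n : ℝ)) * supNorm ((rblk L R' x₁).1 - (rblk L R' x₂).1) ≤ 1 / (n : ℝ) := by
      have hb : supNorm ((rblk L R' x₁).1 - (rblk L R' x₂).1) ≤ 1 :=
        supNorm_blk_sub_blk_le_one hL (supNorm_sub_le_one_of_mem_nbrs h12)
      exact (mul_le_mul_of_nonneg_left hb (by positivity)).trans (by rw [mul_one])
    have h1 : |dT n (R'.image (blk L)) T hT (rblk L R' x₁) - dT n (R'.image (blk L)) T hT (rblk L R' x₂)| ≤ 1 / (n : ℝ) :=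
      (abs_dT_sub_le hn T hT _ _).trans hkey
    have hnL' : (δ * L) * (1 / ((n * L : ℕ) : ℝ)) = δ * (1 / (n : ℝ)) := by push_cast; field_simp
    rw [hnL']
    exact mul_le_mul_of_nonneg_left h1 hδ0
  have hblockB : ∀ x₁ x₂ : ↥R', blk (n * L) x₁.1 = blk (n * L) x₂.1 → |ρ' x₁ - ρ' x₂| ≤ δ := by
    intro x₁ x₂ h12
    simp only [hρ', ← mul_sub, abs_mul, abs_of_nonneg hδ0]
    have hbb : blk n (rblk L R' x₁).1 = blk n (rblk L R' x₂).1 := by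
      show blk n (blk L x₁.1) = blk n (blk L x₂.1)
      rw [blk_blk, blk_blk, Nat.mul_comm]; exact h12
    refine (mul_le_mul_of_nonneg_left ((abs_dT_sub_le hn T hT _ _).trans ?_) hδ0).trans (by rw [mul_one])
    calc (1 / (n : ℝ)) * supNorm ((rblk L R' x₁).1 - (rblk L R' x₂).1) ≤ (1 / (n : ℝ)) * ((n : ℝ) - 1) :=
          mul_le_mul_of_nonneg_left (supNorm_sub_le_of_blk_eq hn hbb) (by positivity)
      _ ≤ 1 := by rw [div_mul_eq_mul_div, one_mul, div_le_one hn0]; linarith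
  have h₁ : ∀ u, -(σ / 2) * (u ⬝ᵥ u) ≤ ∑ j, ∑ k, (Real.exp (ρ j - ρ k) - 1) * runB hR'L n a j k * (u j * u k) := by
    intro u
    have hδn : (δ * L) * (1 / ((n * L : ℕ) : ℝ)) ≤ 1 := by
      have : (δ * L) * (1 / ((n * L : ℕ) : ℝ)) = δ * (1 / (n : ℝ)) := by push_cast; field_simp
      rw [this]
      calc δ * (1 / (n : ℝ)) ≤ 1 * 1 := mul_le_mul hδ1 (by rw [div_le_one hn0]; exact_mod_cast hn) (by positivity) zero_le_one
        _ = 1 := one_mul 1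
    have hM := conjError_fineOpR_ge hnL hR' ha.le hδn hδ0 ρ' hbondB hblockB
    have h := conjError_congr_ge (coordT hR'L) (fineOpR (n * L) a 0 R') (c := ((L : ℝ) ^ (d + 1))⁻¹)
      (κM := 2 * ((d : ℝ) + 1) * (δ * L) ^ 2 + a * (Real.exp δ - 1)) (CT := (L : ℝ) ^ (d + 1) + 1) (by positivity)
      (by nlinarith [mul_nonneg ha.le hexp, sq_nonneg (δ * L)]) ρ ρ' hcompat hM (coordT_le_dot hR'L) u
    have hu : 0 ≤ u ⬝ᵥ u := by simp only [dotProduct]; exact Finset.sum_nonneg fun _ _ => mul_self_nonneg _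
    have hcC : ((L : ℝ) ^ (d + 1))⁻¹ * ((L : ℝ) ^ (d + 1) + 1) ≤ 2 := by
      rw [inv_mul_eq_div, div_le_iff₀ hLpow]; linarith
    have hκ : ((L : ℝ) ^ (d + 1))⁻¹ * (2 * ((d : ℝ) + 1) * (δ * L) ^ 2 + a * (Real.exp δ - 1)) * ((L : ℝ) ^ (d + 1) + 1) ≤ σ / 2 := by
      have hk0 : 0 ≤ 2 * ((d : ℝ) + 1) * (δ * L) ^ 2 + a * (Real.exp δ - 1) := by
        nlinarith [mul_nonneg ha.le hexp, sq_nonneg (δ * L)]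
      calc ((L : ℝ) ^ (d + 1))⁻¹ * (2 * ((d : ℝ) + 1) * (δ * L) ^ 2 + a * (Real.exp δ - 1)) * ((L : ℝ) ^ (d + 1) + 1)
          = (((L : ℝ) ^ (d + 1))⁻¹ * ((L : ℝ) ^ (d + 1) + 1)) * (2 * ((d : ℝ) + 1) * (δ * L) ^ 2 + a * (Real.exp δ - 1)) := by ring
        _ ≤ 2 * (2 * ((d : ℝ) + 1) * (δ * L) ^ 2 + a * (Real.exp δ - 1)) := mul_le_mul_of_nonneg_right hcC hk0
        _ ≤ σ / 2 := hsmall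
    exact le_trans (by nlinarith) h
  have hHB : fromBlocks (runB hR'L n a).toBlocks₁₁ (runB hR'L n a).toBlocks₁₂ (runB hR'L n a).toBlocks₂₁
      (runB hR'L n a).toBlocks₂₂ = runB hR'L n a := fromBlocks_toBlocks _
  refine ⟨fun w => ?_, fun w => ?_⟩
  · exact coercive_extOpR _ _ _ _ _ hP₀ (by rw [hHB]; exact hH₁) hs0 hs1 w
  · exact conjError_extOpR_ge _ _ _ _ _ ρ h₀ (by rw [hHB]; exact h₁) hs0 hs1 w

end Weight

end Summit.QuantumFields.BalabanUV.T4Continuum.NE7K1LinSchurLineU1Energy
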